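import Summits.CriticalPhenomena.PercolationContinuityZ3.Theorems.Transplant.SkelPhiRunKitsGHab
import Summits.CriticalPhenomena.PercolationContinuityZ3.Theorems.Transplant.SkelPhiParaRouteSetsC
import HarnessLib

/-!
# N1 (the `{±1}` node), LEVEL 1, (C) column under S1 (C-STEP0.md §4–§5): THE KIT CLAUSES OF THE ONE-FRAME CORRIDOR OVER A HABITAT, FROM THE
# STEP-I″ INPUTS AT EVERY CENTRE — PART 1: THE ROUNDS (segments A, B) — `hkits` of `kitsAt_stepAF` at level `j` of step `k` for: signed v-rounds
# (`vLocPrmD … .scheduleN 1 0`), u-rounds (`xLocPrm … .scheduleN 0 0`), the signed x-band (`xPrmW … .scheduleN 0 σB 0`) and the signed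
# y′-band (`yPrmX … .scheduleN 1 σB 0`), all read in ONE frame `runX φ c₀ n_L h_L 1`: p1's `kitClause_runXGHab` (σ := 1, ABSTRACT exit pieces `Pex/hPex` — p1's orientation-aware table `pexXO` discharges them) with (h1) the zone,
# (h2) the short exit links and (h3) my route sets (`routeSetsN_vlocDIn/_locIn/_xbandIn/_ybandIn`); far contacts through the window rim,
# padded contacts through `hpadT` — verbatim the shape of p1's `hkits_runXGHab`.  Rounds ask the long links for BOTH stride signs.

builds on p205010 (kernel theorem, internal audit signed; external expert review pending) — nothing in this file uses p205010; nothing here is a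
claim about the open node `SamePDropOfSkeletonNeg`.
Lane `prim-bschramm`, seat `prim-bschramm-p5` (gen 9; (C) lineage); helper file (`--supports stmt-CriticalPhenomena-4575`).
* **`hkits_vlocDHab`** (signed v-rounds), **`hkits_locHab`** (u-rounds). Bands: `SkelPhiParaKitsCBand`.
[cite: KozmaNitzan2024, §4 Lemma 10 (pp. 17–21), Lemma 11 (pp. 22–23), Lemma 12 (pp. 23–25)] [cite: MartineauTassion2017, §4.3 Lemma 4.2]
-/

noncomputable section

open scoped Classical

namespace Summit.CriticalPhenomena.PercolationContinuityZ3.Theorems.Transplant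

namespace Skelφ

open MeasureTheory
open Literature.Probability.Percolation Literature.Probability.LatticeModels SimpleGraph KNLevels
open Literature.Barriers.CriticalPhenomena (graphBall graphBall_finite mem_graphBall_self graphBall_mono)
open Skel (winGraph winGraph_adj winGraph_le winGraphIn winGraphIn_le KitGeom)
open SkelI (tanOff tanTgt tanTgt_mem)
open Literature.Probability.Percolation.KozmaNitzan.Cells (oth oth_ne eq_oth_of_ne oth_oth)
open ChainPlanar ChainPara

variable {V : Type} [DecidableEq V] {G : SimpleGraph V} [G.LocallyFinite] {φ : V → Site 2}

/-- **THE KIT CLAUSE OF A SIGNED v-ROUND (segment A) LEVEL OVER A HABITAT FROM THE INPUTS AT EVERY CENTRE** (`hkits` of `kitsAt_stepAF` at level `j` of step `k`):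
frame `runX φ c₀ n_L h_L 1` around `w₀` (radius `R`), level box `[lo k − j, hi k + j]` of `(vLocPrmD n_L ℓ_L h_L v_L e W L0 Nr).scheduleN 1 0` (drift-localisation along the level axis), region `Dr ⊇ Win(region k)` with the
subbox weighting `Wt`, target `T ⊇ Win(core (k+1)) ∪ (far part of the level)`; inputs at every centre `c`: the zone `(M_u)`, the eight short exit
links (abstract pieces `Pex`), the long links = the four long top pieces `σ, τ = ±1` (split `v_L`). [cite: KozmaNitzan2024, §4 Lemma 10 (pp. 17–21)] [cite: MartineauTassion2017, §4.3 Lemma 4.2] -/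
theorem hkits_vlocDHab [Countable V] {types : Finset V} (hlipφ : Lip G φ) (hstep : Steps G φ) (hfr : Frames G φ types) (hκ : CylConn G φ types)
    {Δ : ℕ} (hΔ : ∀ v, G.degree v ≤ Δ) {q : unitInterval} {δ : ℝ} (hδ : 0 < δ)
    -- the run data, the frame of sign `1`, the schedule
    {nL : ℕ} (hnL : 1 ≤ nL) (c₀ : V) (hL : ℤ) {kq : ℕ} (hκL : hL.natAbs ≤ kq * nL) {ℓL : ℕ} {vL : ℤ} {e W : ℕ} (hvL : |vL| ≤ nL) (hWn : nL ≤ W)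
    (he : ((e : ℤ) + 2) * ((nL + hL.natAbs : ℕ) : ℤ) ≤ (nL : ℤ) * ℓL + 1) (L0 Nr : ℕ)
    {k j : ℕ} {w₀ : V} {R r Rl Mz : ℕ}
    -- kit constants
    (P : ApronPrm) {Rs Kmax KCmax rs cS cU : ℕ} (hPN : kq + 3 ≤ P.N) (hA : P.A = (Mz + 1 : ℕ) * (shearUnit nL hL : ℤ) + 1)
    (hd1 : P.W + P.ℓ ≤ P.d) (hD1 : P.W + P.ℓ + P.d + 2 ≤ shellD P) (hD2 : P.ℓ + Rs + P.d + 3 ≤ shellD P) (hDρ : Rs + 1 ≤ shellD P)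
    (hℓ : 1 ≤ P.ℓ) (hW : Rs + P.ℓ ≤ P.W) (hKmax : (shellD P + P.W) * (kq + 1) ≤ Kmax) (hKCmax : (shellD P + Mz + 1) * (kq + 1) ≤ KCmax)
    (hR' : cylRadMax G φ types P.ℓ (Rs + KCmax + (P.W + Kmax)) ≤ P.R')
    (hwide : ∀ i, (((vLocPrmD nL ℓL hL vL e W L0 Nr).scheduleN 1 0 (vLocPrmD_ok hnL hvL hWn he L0 Nr) (vLocPrmD_dL hvL e W L0 Nr)).lo k - (j : Site 2)) i + 2 * tanOff P.ℓs P.M ≤ (((vLocPrmD nL ℓL hL vL e W L0 Nr).scheduleN 1 0 (vLocPrmD_ok hnL hvL hWn he L0 Nr) (vLocPrmD_dL hvL e W L0 Nr)).hi k + (j : Site 2)) i)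
    (hdw : ∀ i, (((vLocPrmD nL ℓL hL vL e W L0 Nr).scheduleN 1 0 (vLocPrmD_ok hnL hvL hWn he L0 Nr) (vLocPrmD_dL hvL e W L0 Nr)).lo k - (j : Site 2)) i + (P.d + 2 : ℕ) ≤ (((vLocPrmD nL ℓL hL vL e W L0 Nr).scheduleN 1 0 (vLocPrmD_ok hnL hvL hWn he L0 Nr) (vLocPrmD_dL hvL e W L0 Nr)).hi k + (j : Site 2)) i)
    (hDw : ∀ i, (((vLocPrmD nL ℓL hL vL e W L0 Nr).scheduleN 1 0 (vLocPrmD_ok hnL hvL hWn he L0 Nr) (vLocPrmD_dL hvL e W L0 Nr)).lo k - (j : Site 2)) i + ((shellD P + 1 + P.d + KCmax + Rs : ℕ) : ℤ) ≤ (((vLocPrmD nL ℓL hL vL e W L0 Nr).scheduleN 1 0 (vLocPrmD_ok hnL hvL hWn he L0 Nr) (vLocPrmD_dL hvL e W L0 Nr)).hi k + (j : Site 2)) i)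
    (hT : (P.W : ℤ) + Kmax + P.ℓ + 1 ≤ tanOff P.ℓs P.M) (hT' : (shellD P : ℤ) + KCmax + Rs ≤ tanOff P.ℓs P.M)
    (hr₀ : P.N * (tanOff P.ℓs P.M + 2) + P.N * P.d + (P.W + Kmax + P.R') + (KCmax + Rs) ≤ P.r₀) (hR : P.r₀ ≤ R)
    (hrs : 2 * (1 + P.N * (tanOff P.ℓs P.M + 2) + P.N * P.d + (P.W + Kmax + P.R') + (KCmax + Rs)) ≤ rs)
    (hcS : (P.N + 1) * (tanOff P.ℓs P.M + 1) + (P.N + 1) * P.d + (2 * P.W + 1) * (Kmax + 1) * (Δ + 1) ^ P.R' ≤ cS)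
    -- the reach of the kit centre: inside the `R′`-enlargement, and `B(w₀, R − r)` with `Rl ≤ r ≤ R`
    (hE : j + (P.N * (tanOff P.ℓs P.M + 1) + P.N * P.d + KCmax) ≤ ((vLocPrmD nL ℓL hL vL e W L0 Nr).scheduleN 1 0 (vLocPrmD_ok hnL hvL hWn he L0 Nr) (vLocPrmD_dL hvL e W L0 Nr)).R')
    (hreach : r + (P.N * (tanOff P.ℓs P.M + 1) + P.N * P.d + KCmax) ≤ P.r₀) (hr : Rl ≤ r) (hrR : r ≤ R)
    -- the short region, the zone family, the short pieces
    (Rg : V → Finset V) (hRg : ∀ c, ∀ u ∈ Rg c, u ∈ graphBall G c Rs) (hRgcard : ∀ c, (Rg c).card ≤ cU) (hcU1 : 1 ≤ cU)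
    (Λc : V → ℕ → Finset V) (kz : ℕ) (hkn : ∀ c, Λc c kz ⊆ Λc c Mz) (hΛ : ∀ c, ∀ v ∈ Λc c Mz, v ∈ Rg c ∧ φ v - φ c ∈ box 2 Mz)
    (hZ : ∀ c, (↑(Λc c Mz) : Set V) ⊆ cyl φ c Mz)
    (hclear : (Mz + 4) * (nL + hL.natAbs) ≤ nL * (ℓL + 1))
    (Pex : Fin 2 → ℤˣ → V → Finset V)
    (hPex : ∀ (i : Fin 2) (σ₀ : ℤˣ) (c : V), ∀ v ∈ Pex i σ₀ c, v ∈ Rg c ∧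
      (runXSideU (φ := φ) c₀ hnL hL (Or.inl rfl) (((vLocPrmD nL ℓL hL vL e W L0 Nr).scheduleN 1 0 (vLocPrmD_ok hnL hvL hWn he L0 Nr) (vLocPrmD_dL hvL e W L0 Nr)).lo k - (j : Site 2)) (((vLocPrmD nL ℓL hL vL e W L0 Nr).scheduleN 1 0 (vLocPrmD_ok hnL hvL hWn he L0 Nr) (vLocPrmD_dL hvL e W L0 Nr)).hi k + (j : Site 2)) i σ₀).lin (φ v) + P.A +
        ((runXSideU (φ := φ) c₀ hnL hL (Or.inl rfl) (((vLocPrmD nL ℓL hL vL e W L0 Nr).scheduleN 1 0 (vLocPrmD_ok hnL hvL hWn he L0 Nr) (vLocPrmD_dL hvL e W L0 Nr)).lo k - (j : Site 2)) (((vLocPrmD nL ℓL hL vL e W L0 Nr).scheduleN 1 0 (vLocPrmD_ok hnL hvL hWn he L0 Nr) (vLocPrmD_dL hvL e W L0 Nr)).hi k + (j : Site 2)) i σ₀).s : ℤ) *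
          coef (runXSideU (φ := φ) c₀ hnL hL (Or.inl rfl) (((vLocPrmD nL ℓL hL vL e W L0 Nr).scheduleN 1 0 (vLocPrmD_ok hnL hvL hWn he L0 Nr) (vLocPrmD_dL hvL e W L0 Nr)).lo k - (j : Site 2)) (((vLocPrmD nL ℓL hL vL e W L0 Nr).scheduleN 1 0 (vLocPrmD_ok hnL hvL hWn he L0 Nr) (vLocPrmD_dL hvL e W L0 Nr)).hi k + (j : Site 2)) i σ₀).cα
            (runXSideU (φ := φ) c₀ hnL hL (Or.inl rfl) (((vLocPrmD nL ℓL hL vL e W L0 Nr).scheduleN 1 0 (vLocPrmD_ok hnL hvL hWn he L0 Nr) (vLocPrmD_dL hvL e W L0 Nr)).lo k - (j : Site 2)) (((vLocPrmD nL ℓL hL vL e W L0 Nr).scheduleN 1 0 (vLocPrmD_ok hnL hvL hWn he L0 Nr) (vLocPrmD_dL hvL e W L0 Nr)).hi k + (j : Site 2)) i σ₀).cβ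
            (runXSideU (φ := φ) c₀ hnL hL (Or.inl rfl) (((vLocPrmD nL ℓL hL vL e W L0 Nr).scheduleN 1 0 (vLocPrmD_ok hnL hvL hWn he L0 Nr) (vLocPrmD_dL hvL e W L0 Nr)).lo k - (j : Site 2)) (((vLocPrmD nL ℓL hL vL e W L0 Nr).scheduleN 1 0 (vLocPrmD_ok hnL hvL hWn he L0 Nr) (vLocPrmD_dL hvL e W L0 Nr)).hi k + (j : Site 2)) i σ₀).a ≤
      (runXSideU (φ := φ) c₀ hnL hL (Or.inl rfl) (((vLocPrmD nL ℓL hL vL e W L0 Nr).scheduleN 1 0 (vLocPrmD_ok hnL hvL hWn he L0 Nr) (vLocPrmD_dL hvL e W L0 Nr)).lo k - (j : Site 2)) (((vLocPrmD nL ℓL hL vL e W L0 Nr).scheduleN 1 0 (vLocPrmD_ok hnL hvL hWn he L0 Nr) (vLocPrmD_dL hvL e W L0 Nr)).hi k + (j : Site 2)) i σ₀).lin (φ c))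
    -- the level's source/support, the weighting on the region, the target
    {Ω : Finset V} (hfull : winLevel G (runX φ c₀ nL hL 1) w₀ R (((vLocPrmD nL ℓL hL vL e W L0 Nr).scheduleN 1 0 (vLocPrmD_ok hnL hvL hWn he L0 Nr) (vLocPrmD_dL hvL e W L0 Nr)).lo k) (((vLocPrmD nL ℓL hL vL e W L0 Nr).scheduleN 1 0 (vLocPrmD_ok hnL hvL hWn he L0 Nr) (vLocPrmD_dL hvL e W L0 Nr)).hi k) j ⊆ Ω)
    (kk : ℕ) (o : V) (Sfin : Finset V) {Wt : Sym2 V → unitInterval} {Dr T : Finset V} (hDrΩ : Dr ⊆ Ω) (hWD : IsSubbox (winGraphIn G Ω) Wt q Dr)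
    (hPD : Win G (runX φ c₀ nL hL 1) w₀ (((vLocPrmD nL ℓL hL vL e W L0 Nr).scheduleN 1 0 (vLocPrmD_ok hnL hvL hWn he L0 Nr) (vLocPrmD_dL hvL e W L0 Nr)).region k) R ⊆ Dr)
    (hXD : winLevelIn (runX φ c₀ nL hL 1) Ω (((vLocPrmD nL ℓL hL vL e W L0 Nr).scheduleN 1 0 (vLocPrmD_ok hnL hvL hWn he L0 Nr) (vLocPrmD_dL hvL e W L0 Nr)).lo k) (((vLocPrmD nL ℓL hL vL e W L0 Nr).scheduleN 1 0 (vLocPrmD_ok hnL hvL hWn he L0 Nr) (vLocPrmD_dL hvL e W L0 Nr)).hi k) j ⊆ Dr)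
    (hPT : Win G (runX φ c₀ nL hL 1) w₀ (((vLocPrmD nL ℓL hL vL e W L0 Nr).scheduleN 1 0 (vLocPrmD_ok hnL hvL hWn he L0 Nr) (vLocPrmD_dL hvL e W L0 Nr)).core (k + 1)) R ⊆ T)
    (hpadT : ∀ x ∈ outerBoundary (winGraphIn G Ω) (winLevelIn (runX φ c₀ nL hL 1) Ω (((vLocPrmD nL ℓL hL vL e W L0 Nr).scheduleN 1 0 (vLocPrmD_ok hnL hvL hWn he L0 Nr) (vLocPrmD_dL hvL e W L0 Nr)).lo k) (((vLocPrmD nL ℓL hL vL e W L0 Nr).scheduleN 1 0 (vLocPrmD_ok hnL hvL hWn he L0 Nr) (vLocPrmD_dL hvL e W L0 Nr)).hi k) j),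
      x ∉ outerBoundary (winGraph G w₀ R) (winLevel G (runX φ c₀ nL hL 1) w₀ R (((vLocPrmD nL ℓL hL vL e W L0 Nr).scheduleN 1 0 (vLocPrmD_ok hnL hvL hWn he L0 Nr) (vLocPrmD_dL hvL e W L0 Nr)).lo k) (((vLocPrmD nL ℓL hL vL e W L0 Nr).scheduleN 1 0 (vLocPrmD_ok hnL hvL hWn he L0 Nr) (vLocPrmD_dL hvL e W L0 Nr)).hi k) j) →
      inNbrIn G (runX φ c₀ nL hL 1) Ω (Finset.Icc (((vLocPrmD nL ℓL hL vL e W L0 Nr).scheduleN 1 0 (vLocPrmD_ok hnL hvL hWn he L0 Nr) (vLocPrmD_dL hvL e W L0 Nr)).lo k - (j : Site 2)) (((vLocPrmD nL ℓL hL vL e W L0 Nr).scheduleN 1 0 (vLocPrmD_ok hnL hvL hWn he L0 Nr) (vLocPrmD_dL hvL e W L0 Nr)).hi k + (j : Site 2))) x ∈ T)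
    (hfarT : ∀ v ∈ winLevel G (runX φ c₀ nL hL 1) w₀ R (((vLocPrmD nL ℓL hL vL e W L0 Nr).scheduleN 1 0 (vLocPrmD_ok hnL hvL hWn he L0 Nr) (vLocPrmD_dL hvL e W L0 Nr)).lo k) (((vLocPrmD nL ℓL hL vL e W L0 Nr).scheduleN 1 0 (vLocPrmD_ok hnL hvL hWn he L0 Nr) (vLocPrmD_dL hvL e W L0 Nr)).hi k) j, v ∉ graphBall G w₀ (R - P.r₀) → v ∈ T)
    {N : ℕ} (hN : kk * (Δ + 1) ^ (2 * rs) ≤ N) (hk : (1 - (q : ℝ) ^ (1 + Δ * cS + cS * cU)) ^ kk ≤ δ)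
    -- THE INPUTS AT EVERY CENTRE: zone, short exit links, long links
    (hzone : ∀ c, 1 - δ ^ 2 < (bondPercolation G q).real (UniqZone.zone G (Λc c) kz Mz))
    (hexit : ∀ c (i : Fin 2) (σ₀ : ℤˣ), 1 - δ ^ 2 < (bondPercolation G q).real (linkIn (↑(Rg c) : Set V) (Λc c kz) (Pex i σ₀ c)))
    (hlong : ∀ c (σ τ : ℤ), σ = 1 ∨ σ = -1 → τ = 1 ∨ τ = -1 → 1 - δ ^ 2 < (bondPercolation G q).real
      (linkIn (pgramPrism G φ c nL hL (3 * ℓL) Rl) (Λc c kz) (pgTopPieceW G φ c nL hL ℓL Rl σ τ vL))) :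
    ∃ (σ' : SData V) (S : Finset V),
      SHyp (winLDataIn G (runX φ c₀ nL hL 1) Ω (((vLocPrmD nL ℓL hL vL e W L0 Nr).scheduleN 1 0 (vLocPrmD_ok hnL hvL hWn he L0 Nr) (vLocPrmD_dL hvL e W L0 Nr)).lo k) (((vLocPrmD nL ℓL hL vL e W L0 Nr).scheduleN 1 0 (vLocPrmD_ok hnL hvL hWn he L0 Nr) (vLocPrmD_dL hvL e W L0 Nr)).hi k) o Sfin) j σ' ∧
      σ'.N ≤ N ∧ (1 - (q : ℝ) ^ σ'.sB) ^ σ'.k ≤ δ ∧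
      S ⊆ (winLDataIn G (runX φ c₀ nL hL 1) Ω (((vLocPrmD nL ℓL hL vL e W L0 Nr).scheduleN 1 0 (vLocPrmD_ok hnL hvL hWn he L0 Nr) (vLocPrmD_dL hvL e W L0 Nr)).lo k) (((vLocPrmD nL ℓL hL vL e W L0 Nr).scheduleN 1 0 (vLocPrmD_ok hnL hvL hWn he L0 Nr) (vLocPrmD_dL hvL e W L0 Nr)).hi k) o Sfin).X j ∧
      S ⊆ Dr ∧ (∀ x ∈ σ'.K, ∀ e ∈ σ'.seed x, e ∉ wireSet (↑S : Set V)) ∧ (∀ x ∈ σ'.K, σ'.face x ⊆ S) ∧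
      (∀ x ∈ σ'.K, 1 - 3 * δ ≤ (prodBernoulli Wt).real {ω | ∃ u ∈ σ'.face x,
        1 - δ < (prodBernoulli (pinW Wt (wireSet (↑S : Set V)) ω)).real (⋃ t ∈ T, openConnIn (↑Dr : Set V) u t)}) := by
  set SN := (vLocPrmD nL ℓL hL vL e W L0 Nr).scheduleN 1 0 (vLocPrmD_ok hnL hvL hWn he L0 Nr) (vLocPrmD_dL hvL e W L0 Nr) with hSN
  set ψ := runX φ c₀ nL hL 1 with hψ
  have hσ : (1 : ℤ) = 1 ∨ (1 : ℤ) = -1 := Or.inl rfl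
  set SF := runXSideU (φ := φ) c₀ hnL hL hσ (SN.lo k - (j : Site 2)) (SN.hi k + (j : Site 2)) with hSF
  have hKeq : winLevel G ψ w₀ R (SN.lo k) (SN.hi k) j = Win G ψ w₀ (Finset.Icc (SN.lo k - (j : Site 2)) (SN.hi k + (j : Site 2))) R := rfl
  -- the frame facts used for the reach
  have hlip : Lip G ψ := lip_runX hlipφ hσ hnL c₀ hL
  have hq : QStepsN G ψ P.N := (qStepsN_runX hstep hnL c₀ hL hσ hκL).mono hPN
  have hU1 : (1 : ℤ) ≤ (shearUnit nL hL : ℤ) := by have := shearUnit_pos hnL hL; omega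
  have hU : (shearUnit nL hL : ℤ) ≤ ((kq + 1 : ℕ) : ℤ) * nL := by
    have : ((shearUnit nL hL : ℕ) : ℤ) = nL + (hL.natAbs : ℤ) := by unfold shearUnit; push_cast; ring
    rw [this]; push_cast
    have : (hL.natAbs : ℤ) ≤ kq * nL := by exact_mod_cast hκL
    linarith
  have haff : ∀ (i : Fin 2) (σ₀ : ℤˣ), (SF i σ₀).IsAffine (shearUnit nL hL : ℤ) (if i = 0 then (shearUnit nL hL : ℤ) else nL) := fun i σ₀ => by
    rw [hSF]; exact runXSideU_isAffine c₀ hnL hL hσ _ _ i σ₀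
  have hC : ∀ (i : Fin 2) (σ₀ : ℤˣ), (nL : ℤ) ≤ (if i = 0 then (shearUnit nL hL : ℤ) else nL) := fun i σ₀ => by
    split_ifs
    · have : ((shearUnit nL hL : ℕ) : ℤ) = nL + (hL.natAbs : ℤ) := by unfold shearUnit; push_cast; ring
      rw [this]; linarith [Int.natCast_nonneg hL.natAbs]
    · exact le_rfl
  have hKC := hKC_of_affine SF haff hU1 P hnL hC hU hA hKCmax
  refine kitClause_runXGHab hlipφ hstep hfr hκ hΔ hδ hnL c₀ hL hσ hκL P hPN hA hd1 hD1 hD2 hDρ hℓ hW hKmax hKCmax hR' hwide hdw hDw hT hT'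
    hr₀ hR hrs hcS Rg hRg hRgcard hcU1 Λc kz hkn hΛ Pex hPex hfull kk o Sfin hWD hXD hN hk hpadT (fun x hx hfar => ?_)
    (fun x hx hnear => ?_)
  · -- FAR: the inner neighbour lies in the level and outside `B(w₀, R − r₀)`
    refine hfarT _ ?_ hfar
    have h := inNbr_spec (G := G) (φ := ψ) (by rw [hKeq] at hx; exact hx)
    rw [hKeq]
    exact (mem_Win G ψ).2 ⟨h.2.1, h.2.2⟩
  · -- NEAR: zone, exit link, route datum at the kit centre
    refine Or.inr ⟨hzone _, hexit _ _ _, ?_⟩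
    have hx' : x ∈ outerBoundary (winGraph G w₀ R) (Win G ψ w₀ (Finset.Icc (SN.lo k - (j : Site 2)) (SN.hi k + (j : Site 2))) R) := by
      rw [hKeq] at hx; exact hx
    set c := ctCtr G SF P w₀ R x with hc
    have hcI : ψ c ∈ Finset.Icc (SN.lo k - ((SN.R' : ℕ) : Site 2)) (SN.hi k + ((SN.R' : ℕ) : Site 2)) :=
      ψ_ctCtr_mem_Icc SF hlip hq hstep hwide (fun i σ₀ z h1 h2 => hKC i σ₀ z h1) hE hx
    have hcw : c ∈ graphBall G w₀ (R - r) := by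
      have hd := ctCtr_reach SF hlip hq hstep hwide (fun i σ₀ z h1 h2 => hKC i σ₀ z h1) hx'
      have h := BoxProdZ2.mem_graphBall_add G hnear hd
      exact graphBall_mono G _ (by omega) h
    exact routeSetsN_vlocDIn (φ := φ) hnL hvL hWn he L0 Nr c₀ hcI hcw hr hrR (hZ c) hclear hPD hPT hDrΩ hWD
      (hlong c _ _ (LocPrm.dir_eq_or _) (LocPrm.steerT_eq_or _ _))

/-- **THE KIT CLAUSE OF A u-ROUND (segment B) LEVEL OVER A HABITAT FROM THE INPUTS AT EVERY CENTRE** (`hkits` of `kitsAt_stepAF` at level `j` of step `k`):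
frame `runX φ c₀ n_L h_L 1` around `w₀` (radius `R`), level box `[lo k − j, hi k + j]` of `(xLocPrm n_L ℓ_L h_L e W L0 Nr).scheduleN 0 0` (localisation along `α`), region `Dr ⊇ Win(region k)` with the
subbox weighting `Wt`, target `T ⊇ Win(core (k+1)) ∪ (far part of the level)`; inputs at every centre `c`: the zone `(M_u)`, the eight short exit
links (abstract pieces `Pex`), the long links = the four long side halves `σ, τ = ±1`. [cite: KozmaNitzan2024, §4 Lemma 10 (pp. 17–21)] [cite: MartineauTassion2017, §4.3 Lemma 4.2] -/
theorem hkits_locHab [Countable V] {types : Finset V} (hlipφ : Lip G φ) (hstep : Steps G φ) (hfr : Frames G φ types) (hκ : CylConn G φ types)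
    {Δ : ℕ} (hΔ : ∀ v, G.degree v ≤ Δ) {q : unitInterval} {δ : ℝ} (hδ : 0 < δ)
    -- the run data, the frame of sign `1`, the schedule
    {nL : ℕ} (hnL : 1 ≤ nL) (c₀ : V) (hL : ℤ) {kq : ℕ} (hκL : hL.natAbs ≤ kq * nL) {ℓL e W : ℕ} (he : e ≤ nL) (hWl : nL * ℓL / shearUnit nL hL + 1 ≤ W) (L0 Nr : ℕ)
    {k j : ℕ} {w₀ : V} {R r Rl Mz : ℕ}
    -- kit constants
    (P : ApronPrm) {Rs Kmax KCmax rs cS cU : ℕ} (hPN : kq + 3 ≤ P.N) (hA : P.A = (Mz + 1 : ℕ) * (shearUnit nL hL : ℤ) + 1)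
    (hd1 : P.W + P.ℓ ≤ P.d) (hD1 : P.W + P.ℓ + P.d + 2 ≤ shellD P) (hD2 : P.ℓ + Rs + P.d + 3 ≤ shellD P) (hDρ : Rs + 1 ≤ shellD P)
    (hℓ : 1 ≤ P.ℓ) (hW : Rs + P.ℓ ≤ P.W) (hKmax : (shellD P + P.W) * (kq + 1) ≤ Kmax) (hKCmax : (shellD P + Mz + 1) * (kq + 1) ≤ KCmax)
    (hR' : cylRadMax G φ types P.ℓ (Rs + KCmax + (P.W + Kmax)) ≤ P.R')
    (hwide : ∀ i, (((xLocPrm nL ℓL hL e W L0 Nr).scheduleN 0 0 (xLocPrm_ok he hWl L0 Nr)).lo k - (j : Site 2)) i + 2 * tanOff P.ℓs P.M ≤ (((xLocPrm nL ℓL hL e W L0 Nr).scheduleN 0 0 (xLocPrm_ok he hWl L0 Nr)).hi k + (j : Site 2)) i)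
    (hdw : ∀ i, (((xLocPrm nL ℓL hL e W L0 Nr).scheduleN 0 0 (xLocPrm_ok he hWl L0 Nr)).lo k - (j : Site 2)) i + (P.d + 2 : ℕ) ≤ (((xLocPrm nL ℓL hL e W L0 Nr).scheduleN 0 0 (xLocPrm_ok he hWl L0 Nr)).hi k + (j : Site 2)) i)
    (hDw : ∀ i, (((xLocPrm nL ℓL hL e W L0 Nr).scheduleN 0 0 (xLocPrm_ok he hWl L0 Nr)).lo k - (j : Site 2)) i + ((shellD P + 1 + P.d + KCmax + Rs : ℕ) : ℤ) ≤ (((xLocPrm nL ℓL hL e W L0 Nr).scheduleN 0 0 (xLocPrm_ok he hWl L0 Nr)).hi k + (j : Site 2)) i)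
    (hT : (P.W : ℤ) + Kmax + P.ℓ + 1 ≤ tanOff P.ℓs P.M) (hT' : (shellD P : ℤ) + KCmax + Rs ≤ tanOff P.ℓs P.M)
    (hr₀ : P.N * (tanOff P.ℓs P.M + 2) + P.N * P.d + (P.W + Kmax + P.R') + (KCmax + Rs) ≤ P.r₀) (hR : P.r₀ ≤ R)
    (hrs : 2 * (1 + P.N * (tanOff P.ℓs P.M + 2) + P.N * P.d + (P.W + Kmax + P.R') + (KCmax + Rs)) ≤ rs)
    (hcS : (P.N + 1) * (tanOff P.ℓs P.M + 1) + (P.N + 1) * P.d + (2 * P.W + 1) * (Kmax + 1) * (Δ + 1) ^ P.R' ≤ cS)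
    -- the reach of the kit centre: inside the `R′`-enlargement, and `B(w₀, R − r)` with `Rl ≤ r ≤ R`
    (hE : j + (P.N * (tanOff P.ℓs P.M + 1) + P.N * P.d + KCmax) ≤ ((xLocPrm nL ℓL hL e W L0 Nr).scheduleN 0 0 (xLocPrm_ok he hWl L0 Nr)).R')
    (hreach : r + (P.N * (tanOff P.ℓs P.M + 1) + P.N * P.d + KCmax) ≤ P.r₀) (hr : Rl ≤ r) (hrR : r ≤ R)
    -- the short region, the zone family, the short pieces
    (Rg : V → Finset V) (hRg : ∀ c, ∀ u ∈ Rg c, u ∈ graphBall G c Rs) (hRgcard : ∀ c, (Rg c).card ≤ cU) (hcU1 : 1 ≤ cU)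
    (Λc : V → ℕ → Finset V) (kz : ℕ) (hkn : ∀ c, Λc c kz ⊆ Λc c Mz) (hΛ : ∀ c, ∀ v ∈ Λc c Mz, v ∈ Rg c ∧ φ v - φ c ∈ box 2 Mz)
    (hZ : ∀ c, (↑(Λc c Mz) : Set V) ⊆ cyl φ c Mz) (hMz : Mz < nL)
    (Pex : Fin 2 → ℤˣ → V → Finset V)
    (hPex : ∀ (i : Fin 2) (σ₀ : ℤˣ) (c : V), ∀ v ∈ Pex i σ₀ c, v ∈ Rg c ∧
      (runXSideU (φ := φ) c₀ hnL hL (Or.inl rfl) (((xLocPrm nL ℓL hL e W L0 Nr).scheduleN 0 0 (xLocPrm_ok he hWl L0 Nr)).lo k - (j : Site 2)) (((xLocPrm nL ℓL hL e W L0 Nr).scheduleN 0 0 (xLocPrm_ok he hWl L0 Nr)).hi k + (j : Site 2)) i σ₀).lin (φ v) + P.A +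
        ((runXSideU (φ := φ) c₀ hnL hL (Or.inl rfl) (((xLocPrm nL ℓL hL e W L0 Nr).scheduleN 0 0 (xLocPrm_ok he hWl L0 Nr)).lo k - (j : Site 2)) (((xLocPrm nL ℓL hL e W L0 Nr).scheduleN 0 0 (xLocPrm_ok he hWl L0 Nr)).hi k + (j : Site 2)) i σ₀).s : ℤ) *
          coef (runXSideU (φ := φ) c₀ hnL hL (Or.inl rfl) (((xLocPrm nL ℓL hL e W L0 Nr).scheduleN 0 0 (xLocPrm_ok he hWl L0 Nr)).lo k - (j : Site 2)) (((xLocPrm nL ℓL hL e W L0 Nr).scheduleN 0 0 (xLocPrm_ok he hWl L0 Nr)).hi k + (j : Site 2)) i σ₀).cα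
            (runXSideU (φ := φ) c₀ hnL hL (Or.inl rfl) (((xLocPrm nL ℓL hL e W L0 Nr).scheduleN 0 0 (xLocPrm_ok he hWl L0 Nr)).lo k - (j : Site 2)) (((xLocPrm nL ℓL hL e W L0 Nr).scheduleN 0 0 (xLocPrm_ok he hWl L0 Nr)).hi k + (j : Site 2)) i σ₀).cβ
            (runXSideU (φ := φ) c₀ hnL hL (Or.inl rfl) (((xLocPrm nL ℓL hL e W L0 Nr).scheduleN 0 0 (xLocPrm_ok he hWl L0 Nr)).lo k - (j : Site 2)) (((xLocPrm nL ℓL hL e W L0 Nr).scheduleN 0 0 (xLocPrm_ok he hWl L0 Nr)).hi k + (j : Site 2)) i σ₀).a ≤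
      (runXSideU (φ := φ) c₀ hnL hL (Or.inl rfl) (((xLocPrm nL ℓL hL e W L0 Nr).scheduleN 0 0 (xLocPrm_ok he hWl L0 Nr)).lo k - (j : Site 2)) (((xLocPrm nL ℓL hL e W L0 Nr).scheduleN 0 0 (xLocPrm_ok he hWl L0 Nr)).hi k + (j : Site 2)) i σ₀).lin (φ c))
    -- the level's source/support, the weighting on the region, the target
    {Ω : Finset V} (hfull : winLevel G (runX φ c₀ nL hL 1) w₀ R (((xLocPrm nL ℓL hL e W L0 Nr).scheduleN 0 0 (xLocPrm_ok he hWl L0 Nr)).lo k) (((xLocPrm nL ℓL hL e W L0 Nr).scheduleN 0 0 (xLocPrm_ok he hWl L0 Nr)).hi k) j ⊆ Ω)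
    (kk : ℕ) (o : V) (Sfin : Finset V) {Wt : Sym2 V → unitInterval} {Dr T : Finset V} (hDrΩ : Dr ⊆ Ω) (hWD : IsSubbox (winGraphIn G Ω) Wt q Dr)
    (hPD : Win G (runX φ c₀ nL hL 1) w₀ (((xLocPrm nL ℓL hL e W L0 Nr).scheduleN 0 0 (xLocPrm_ok he hWl L0 Nr)).region k) R ⊆ Dr)
    (hXD : winLevelIn (runX φ c₀ nL hL 1) Ω (((xLocPrm nL ℓL hL e W L0 Nr).scheduleN 0 0 (xLocPrm_ok he hWl L0 Nr)).lo k) (((xLocPrm nL ℓL hL e W L0 Nr).scheduleN 0 0 (xLocPrm_ok he hWl L0 Nr)).hi k) j ⊆ Dr)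
    (hPT : Win G (runX φ c₀ nL hL 1) w₀ (((xLocPrm nL ℓL hL e W L0 Nr).scheduleN 0 0 (xLocPrm_ok he hWl L0 Nr)).core (k + 1)) R ⊆ T)
    (hpadT : ∀ x ∈ outerBoundary (winGraphIn G Ω) (winLevelIn (runX φ c₀ nL hL 1) Ω (((xLocPrm nL ℓL hL e W L0 Nr).scheduleN 0 0 (xLocPrm_ok he hWl L0 Nr)).lo k) (((xLocPrm nL ℓL hL e W L0 Nr).scheduleN 0 0 (xLocPrm_ok he hWl L0 Nr)).hi k) j),
      x ∉ outerBoundary (winGraph G w₀ R) (winLevel G (runX φ c₀ nL hL 1) w₀ R (((xLocPrm nL ℓL hL e W L0 Nr).scheduleN 0 0 (xLocPrm_ok he hWl L0 Nr)).lo k) (((xLocPrm nL ℓL hL e W L0 Nr).scheduleN 0 0 (xLocPrm_ok he hWl L0 Nr)).hi k) j) →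
      inNbrIn G (runX φ c₀ nL hL 1) Ω (Finset.Icc (((xLocPrm nL ℓL hL e W L0 Nr).scheduleN 0 0 (xLocPrm_ok he hWl L0 Nr)).lo k - (j : Site 2)) (((xLocPrm nL ℓL hL e W L0 Nr).scheduleN 0 0 (xLocPrm_ok he hWl L0 Nr)).hi k + (j : Site 2))) x ∈ T)
    (hfarT : ∀ v ∈ winLevel G (runX φ c₀ nL hL 1) w₀ R (((xLocPrm nL ℓL hL e W L0 Nr).scheduleN 0 0 (xLocPrm_ok he hWl L0 Nr)).lo k) (((xLocPrm nL ℓL hL e W L0 Nr).scheduleN 0 0 (xLocPrm_ok he hWl L0 Nr)).hi k) j, v ∉ graphBall G w₀ (R - P.r₀) → v ∈ T)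
    {N : ℕ} (hN : kk * (Δ + 1) ^ (2 * rs) ≤ N) (hk : (1 - (q : ℝ) ^ (1 + Δ * cS + cS * cU)) ^ kk ≤ δ)
    -- THE INPUTS AT EVERY CENTRE: zone, short exit links, long links
    (hzone : ∀ c, 1 - δ ^ 2 < (bondPercolation G q).real (UniqZone.zone G (Λc c) kz Mz))
    (hexit : ∀ c (i : Fin 2) (σ₀ : ℤˣ), 1 - δ ^ 2 < (bondPercolation G q).real (linkIn (↑(Rg c) : Set V) (Λc c kz) (Pex i σ₀ c)))
    (hlong : ∀ c (σ τ : ℤ), σ = 1 ∨ σ = -1 → τ = 1 ∨ τ = -1 → 1 - δ ^ 2 < (bondPercolation G q).real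
      (linkIn (pgramPrism G φ c nL hL (3 * ℓL) Rl) (Λc c kz) (pgSideHalfW G φ c nL hL ℓL Rl σ (σ * τ)))) :
    ∃ (σ' : SData V) (S : Finset V),
      SHyp (winLDataIn G (runX φ c₀ nL hL 1) Ω (((xLocPrm nL ℓL hL e W L0 Nr).scheduleN 0 0 (xLocPrm_ok he hWl L0 Nr)).lo k) (((xLocPrm nL ℓL hL e W L0 Nr).scheduleN 0 0 (xLocPrm_ok he hWl L0 Nr)).hi k) o Sfin) j σ' ∧
      σ'.N ≤ N ∧ (1 - (q : ℝ) ^ σ'.sB) ^ σ'.k ≤ δ ∧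
      S ⊆ (winLDataIn G (runX φ c₀ nL hL 1) Ω (((xLocPrm nL ℓL hL e W L0 Nr).scheduleN 0 0 (xLocPrm_ok he hWl L0 Nr)).lo k) (((xLocPrm nL ℓL hL e W L0 Nr).scheduleN 0 0 (xLocPrm_ok he hWl L0 Nr)).hi k) o Sfin).X j ∧
      S ⊆ Dr ∧ (∀ x ∈ σ'.K, ∀ e ∈ σ'.seed x, e ∉ wireSet (↑S : Set V)) ∧ (∀ x ∈ σ'.K, σ'.face x ⊆ S) ∧
      (∀ x ∈ σ'.K, 1 - 3 * δ ≤ (prodBernoulli Wt).real {ω | ∃ u ∈ σ'.face x,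
        1 - δ < (prodBernoulli (pinW Wt (wireSet (↑S : Set V)) ω)).real (⋃ t ∈ T, openConnIn (↑Dr : Set V) u t)}) := by
  set SN := (xLocPrm nL ℓL hL e W L0 Nr).scheduleN 0 0 (xLocPrm_ok he hWl L0 Nr) with hSN
  set ψ := runX φ c₀ nL hL 1 with hψ
  have hσ : (1 : ℤ) = 1 ∨ (1 : ℤ) = -1 := Or.inl rfl
  set SF := runXSideU (φ := φ) c₀ hnL hL hσ (SN.lo k - (j : Site 2)) (SN.hi k + (j : Site 2)) with hSF
  have hKeq : winLevel G ψ w₀ R (SN.lo k) (SN.hi k) j = Win G ψ w₀ (Finset.Icc (SN.lo k - (j : Site 2)) (SN.hi k + (j : Site 2))) R := rfl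
  -- the frame facts used for the reach
  have hlip : Lip G ψ := lip_runX hlipφ hσ hnL c₀ hL
  have hq : QStepsN G ψ P.N := (qStepsN_runX hstep hnL c₀ hL hσ hκL).mono hPN
  have hU1 : (1 : ℤ) ≤ (shearUnit nL hL : ℤ) := by have := shearUnit_pos hnL hL; omega
  have hU : (shearUnit nL hL : ℤ) ≤ ((kq + 1 : ℕ) : ℤ) * nL := by
    have : ((shearUnit nL hL : ℕ) : ℤ) = nL + (hL.natAbs : ℤ) := by unfold shearUnit; push_cast; ring
    rw [this]; push_cast
    have : (hL.natAbs : ℤ) ≤ kq * nL := by exact_mod_cast hκL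
    linarith
  have haff : ∀ (i : Fin 2) (σ₀ : ℤˣ), (SF i σ₀).IsAffine (shearUnit nL hL : ℤ) (if i = 0 then (shearUnit nL hL : ℤ) else nL) := fun i σ₀ => by
    rw [hSF]; exact runXSideU_isAffine c₀ hnL hL hσ _ _ i σ₀
  have hC : ∀ (i : Fin 2) (σ₀ : ℤˣ), (nL : ℤ) ≤ (if i = 0 then (shearUnit nL hL : ℤ) else nL) := fun i σ₀ => by
    split_ifs
    · have : ((shearUnit nL hL : ℕ) : ℤ) = nL + (hL.natAbs : ℤ) := by unfold shearUnit; push_cast; ring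
      rw [this]; linarith [Int.natCast_nonneg hL.natAbs]
    · exact le_rfl
  have hKC := hKC_of_affine SF haff hU1 P hnL hC hU hA hKCmax
  refine kitClause_runXGHab hlipφ hstep hfr hκ hΔ hδ hnL c₀ hL hσ hκL P hPN hA hd1 hD1 hD2 hDρ hℓ hW hKmax hKCmax hR' hwide hdw hDw hT hT'
    hr₀ hR hrs hcS Rg hRg hRgcard hcU1 Λc kz hkn hΛ Pex hPex hfull kk o Sfin hWD hXD hN hk hpadT (fun x hx hfar => ?_)
    (fun x hx hnear => ?_)
  · -- FAR: the inner neighbour lies in the level and outside `B(w₀, R − r₀)`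
    refine hfarT _ ?_ hfar
    have h := inNbr_spec (G := G) (φ := ψ) (by rw [hKeq] at hx; exact hx)
    rw [hKeq]
    exact (mem_Win G ψ).2 ⟨h.2.1, h.2.2⟩
  · -- NEAR: zone, exit link, route datum at the kit centre
    refine Or.inr ⟨hzone _, hexit _ _ _, ?_⟩
    have hx' : x ∈ outerBoundary (winGraph G w₀ R) (Win G ψ w₀ (Finset.Icc (SN.lo k - (j : Site 2)) (SN.hi k + (j : Site 2))) R) := by
      rw [hKeq] at hx; exact hx
    set c := ctCtr G SF P w₀ R x with hc
    have hcI : ψ c ∈ Finset.Icc (SN.lo k - ((SN.R' : ℕ) : Site 2)) (SN.hi k + ((SN.R' : ℕ) : Site 2)) :=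
      ψ_ctCtr_mem_Icc SF hlip hq hstep hwide (fun i σ₀ z h1 h2 => hKC i σ₀ z h1) hE hx
    have hcw : c ∈ graphBall G w₀ (R - r) := by
      have hd := ctCtr_reach SF hlip hq hstep hwide (fun i σ₀ z h1 h2 => hKC i σ₀ z h1) hx'
      have h := BoxProdZ2.mem_graphBall_add G hnear hd
      exact graphBall_mono G _ (by omega) h
    exact routeSetsN_locIn (φ := φ) hnL he hWl L0 Nr c₀ hcI hcw hr hrR (hZ c) hMz hPD hPT hDrΩ hWD
      (hlong c _ _ (LocPrm.dir_eq_or _) (LocPrm.steerT_eq_or _ _))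

end Skelφ

end Summit.CriticalPhenomena.PercolationContinuityZ3.Theorems.Transplant

end
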